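import Literature.Geometry.Riemannian.GurskyViaclovskyPath
import HarnessLib
import Literature.Geometry.Riemannian.GurskyViaclovskyOpenness

/-!
# Stub `stub_pathOpen` of line `gv-continuity-path` (crux `EntropyRung.ChangGurskyYang`),
# closed MODULO the openness of Gursky–Viaclovsky's solvable set `𝒮` below `t = 1`
# (Gursky–Viaclovsky 2003, Prop. 2 and §5; Gilbarg–Trudinger, Thm. 17.6)

STUB 5 of the lead's skeleton of line `gv-continuity-path` (crux stmt-SmoothPoincare4-10834,
`Summit.SmoothPoincare4.SmoothPoincare4.Theses.EntropyRung.ChangGurskyYang`; hypothesis `hOpen` of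
its `thm14Psc_of`) is the OPENNESS step of the continuity method of Gursky–Viaclovsky
(J. Differential Geom. 63 (2003) 131–154, arXiv:math/0301350). In print:

* §2, Prop. 2: "Let `u ∈ C²(M)` be a solution of `σ₂^{1/2}(g⁻¹A^t_u) = f(x) e^{2u}`, for some
  `t ≤ 1` with `A^t_u ∈ Γ₂⁺`. Then the linearized operator at `u`, `𝓛^t : C^{2,α}(M) → C^α(M)`, is
  invertible `(0 < α < 1)`", proved by writing solutions as zeroes of
  `F_t[x, u, ∇u, ∇²u] = σ₂(g⁻¹A^t_u) − f(x)² e^{4u}`, computing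
  `𝓛^t(φ) = L^t(g⁻¹A^t_u)_{ij}(g⁻¹∇²φ)_{ij} − 4f² e^{4u} φ + ⋯` ("`⋯` denotes additional terms
  which are linear in `∇φ`"), and concluding "For `t ≤ 1`, Proposition (ellsumm) implies that
  `L^t(g⁻¹A^t_u)` is positive definite, so `𝓛^t` is elliptic. Since the coefficient of `φ` in the
  zeroth-order term is strictly negative, the linearization is furthermore invertible on the
  stated Hölder spaces (see [GT])";
* §5, proof of Thm. 1: "Let `t ∈ 𝒮`, and `u_t` be any solution. From Proposition (linvert), the
  linearized operator at `u_t`, `𝓛^t : C^{2,α}(M) → C^α(M)`, is invertible. The implicit function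
  theorem (see [GT]) implies that `𝒮` is open. Note that since `f ∈ C^∞(M)`, it follows from
  classical elliptic regularity theory that `u_t ∈ C^∞(M)`" — [GT] = Gilbarg–Trudinger, Thm. 17.6
  (the implicit function theorem in Banach spaces: `G[u₀, σ₀] = 0`, `G` continuously
  differentiable at `(u₀, σ₀)`, `G¹_{(u₀,σ₀)}` invertible `⟹` `G[u, σ] = 0` is solvable for `σ` in
  a neighbourhood of `σ₀`).

The line runs the path with the WEYL WEIGHT of Chang–Gursky–Yang 2003, (1.10) (`α = 1`), read on
the conformal metric (`GurskyViaclovskyPath.lean`, module docstring "Dictionary"): a solution at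
`t` is a smooth `u` with `h = e^{−2u} g` Riemannian, `R_h > 0`, and
`P_t(h) = σ₂(A_h) − ¼|W_h|² + (1−t)(2−t)R_h²/6 = q e^{8u}` (`IsPathSolution g h u t q`), i.e. on
the background `g` the equation `σ₂(g⁻¹A^t_u) = (1/16)|W_g|²_g + (q/4) e^{4u}` with
`A^t_u ∈ Γ₂⁺`; `Solvable g t q` is membership `t ∈ 𝒮`. Gursky–Viaclovsky print the unweighted
right side `f(x)² e^{4u}`, and (§1) "The choice of the right hand side in (PDE) is quite flexible;
the key requirement is simply that the exponent is a positive multiple of `u`". For the weighted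
equation the zero-finding map is `F_t − (1/16)|W_g|²_g` with `f² = q/4`: the added term does not
depend on `u`, so the linearisation is the printed `𝓛^t` with zeroth-order coefficient
`−q e^{4u} < 0`, its principal part `L^t(g⁻¹A^t_u)` is untouched (ellipticity needs only
`A^t_u ∈ Γ₂⁺`, `t ≤ 1`), and Prop. 2, the implicit function theorem and elliptic regularity apply
word for word (the right side `(1/16)|W_g|²_g + (q/4)e^{4u}` is `C^∞` in `(x, u)` for `C^∞` `g`, `q`).
Admissibility persists near `t₀`: `σ₂(g⁻¹A^t_{u_t}) > 0` is forced by `q > 0`, hence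
`σ₁ ≠ 0` pointwise (`σ₁² = |A|² + 2σ₂`), and `σ₁ > 0` propagates from `t₀` by continuity of
`t ↦ u_t ∈ C^{2,α}`.

Hölder spaces `C^{k,α}(M)` on a closed manifold, Schauder theory, the Fredholm/maximum-principle
invertibility of `𝓛^t` and fully nonlinear elliptic regularity are NOT in Mathlib or in the tree
(only the abstract Banach-space implicit function theorem is). Following the NEED-A-PUBLISHED-FACT
rule, this file

* STATES the printed openness step, specialised to exactly what the stub consumes, as the named
  fact `gurskyViaclovsky_pathOpen_weighted_four` (written without scoped notation and with fully
  qualified tree names, so that it elaborates under any preamble; tagged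
  `[file Geometry/Riemannian/GurskyViaclovskyOpenness]` for relocation to
  `Literature/Geometry/Riemannian/GurskyViaclovskyOpenness.lean`);
* PROVES the stub conditionally on it: `stub_pathOpen_of_pathOpen` (colon form
  `gurskyViaclovsky_pathOpen_weighted_four → <stub_pathOpen verbatim>`), by definitional
  unfolding: the fact is the stub statement with `𝓡 4`, `𝓘(ℝ)`, `∞` written out.

So `stub_pathOpen` is exactly `stub_pathOpen_of_pathOpen hO` for
`hO : Literature.Geometry.Riemannian.gurskyViaclovsky_pathOpen_weighted_four`, and the line is closed at this leaf MODULO the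
named fact. Nothing shaped like the crux, like Chang–Gursky–Yang's Thm. 1.4 or like
Gursky–Viaclovsky's Thm. 1 as a whole is stated: only the local openness of `𝒮` below `t = 1`.

References: M. J. Gursky, J. A. Viaclovsky, *A fully nonlinear equation on four-manifolds with
positive scalar curvature*, J. Differential Geom. 63 (2003) 131–154, arXiv:math/0301350: §1
((PDE) and the remark on its right-hand side), §2 (Def. 1: `Γ₂⁺`; Prop. 1; `A^t_u`; Prop. 2), §5
(the set `𝒮`, proof of Thm. 1) [GurskyViaclovsky2003]; D. Gilbarg, N. S. Trudinger, *Elliptic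
Partial Differential Equations of Second Order*, Classics in Mathematics, Springer (2001), §17.2,
Thm. 17.6 (p. 447) [GilbargTrudinger2001]; S.-Y. A. Chang, M. J. Gursky, P. C. Yang, *A conformally
invariant sphere theorem in four dimensions*, Publ. Math. IHÉS 98 (2003) 105–143, (1.10)
[ChangGurskyYang2003].
-/

noncomputable section
open scoped Manifold ContDiff Topology
open Set Filter
open Literature.Geometry.Lorentzian (PseudoRiemannianMetric)
open Literature.Geometry.Lorentzian.PseudoRiemannianMetric
open Literature.Geometry.Riemannian
open Literature.Geometry.Riemannian.GurskyViaclovskyPath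

namespace Summit.SmoothPoincare4.SmoothPoincare4.Theorems.GvContinuityPath
set_option linter.dupNamespace false

/-- **STUB 5 of line `gv-continuity-path` (`stub_pathOpen`, verbatim after the hypothesis),
conditional on the named fact `gurskyViaclovsky_pathOpen_weighted_four` (Gursky–Viaclovsky 2003,
Prop. 2 and §5: invertibility of the linearisation at an admissible solution for `t ≤ 1`, the
implicit function theorem of Gilbarg–Trudinger, Thm. 17.6, and elliptic regularity, along the
Weyl-weighted path).** On a closed connected `(M⁴, g)`, for a smooth positive right side `q` and
`t₀ ≤ 1` with `t₀ ∈ 𝒮` (`Solvable g t₀ q`) there is `ε > 0` such that every `t ≤ 1` with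
`t₀ − ε < t < t₀ + ε` is solvable. Proof: the named fact is this statement with the scoped notations
`𝓡 4`, `𝓘(ℝ)`, `∞` written out, so it closes the stub by definitional unfolding.
[cite: GurskyViaclovsky2003, Prop. 2 (§2) and §5 (proof of Thm. 1)]
[cite: GilbargTrudinger2001, Thm. 17.6] -/
theorem stub_pathOpen_of_pathOpen :
    Literature.Geometry.Riemannian.gurskyViaclovsky_pathOpen_weighted_four →
    ∀ (M : Type) [TopologicalSpace M] [T2Space M] [SecondCountableTopology M]
      [ChartedSpace (EuclideanSpace ℝ (Fin 4)) M] [IsManifold (𝓡 4) ∞ M] [CompactSpace M]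
      [ConnectedSpace M]
      (g : PseudoRiemannianMetric (𝓡 4) ∞ (EuclideanSpace ℝ (Fin 4)) (TangentSpace (𝓡 4) : M → Type _))
      [g.HasLeviCivita], g.IsRiemannian →
      ∀ (q : M → ℝ), ContMDiff (𝓡 4) 𝓘(ℝ) ∞ q → (∀ x, 0 < q x) →
      ∀ t₀ : ℝ, t₀ ≤ 1 → Solvable g t₀ q →
        ∃ ε : ℝ, 0 < ε ∧ ∀ t : ℝ, t₀ - ε < t → t < t₀ + ε → t ≤ 1 → Solvable g t q :=
  fun hO ↦ hO

end Summit.SmoothPoincare4.SmoothPoincare4.Theorems.GvContinuityPath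
end
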